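/-
Copyright (c) 2026 the pub-hodgecm-mathlib formalisation cell (harness21).  Prover seat hodgecm-mathlib-K2E5-p16 (g5): Track B «K2-LIT»,
hLiu418 = stmt-HodgeConjecture-24832, ROAD Φ organ Φ6b-6 (β-shift of Shimura's `η` on `Herm₂(ℂ)`), file (4b-iii): growth of the β-shifted
`Ξ` in `h`, locally uniformly in `(α, β) ∈ ℂ × {re β > 0}` (co-dealer rider (b), the face the Φ6b-5 lattice M-test imports); 2026-09-04.
-/
import Summits.HodgeConjecture.HodgeConjecture.Theorems.K2LiuHermTwoEtaShiftGrowth          -- (4b-ii): `norm_etaShift_le₂`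
import Summits.HodgeConjecture.HodgeConjecture.Theorems.K2LiuHermTwoXiEtaIdentity           -- ★ p858047: `posDef_hermTwo_smul`
import Summits.HodgeConjecture.HodgeConjecture.Theorems.K2LiuHermTwoEtaHolomorphy           -- ★ p858099: `differentiable_hermTwoGamma_inv`
import Mathlib.Analysis.SpecialFunctions.Gamma.Beta
import HarnessLib

/-!
# Crux `HLiu418`, ROAD Φ, organ Φ6b-6 — file (4b-iii): growth of `xiShift(g, h; α, β)` in `h`, locally uniformly on `ℂ × {re β > 0}`

Cell `hodgecm-mathlib`, crux item hLiu418 = `stmt-HodgeConjecture-24832`, route of record `HCCMUnconditional`; squad K2, LEAD F0P6-plan (g13),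
co-dealer K2E5-plan (g6) (rider (b) 2026-09-04 07:41:05Z, name proposal `norm_xiShift_le₂`), prover K2E5-p16 (g5).  THEOREMS ONLY; lane
`--supports stmt-HodgeConjecture-24832 --as helper`.

THE ESTIMATE (`norm_xiShift_le₂`, the shifted twin of ★ `norm_xiEtaRhs_le₂`, `1 <` ↦ `0 <`).  For `g > 0` and compact `K ⊂ ℂ`, `L ⊂ {re β > 0}`
there are `C, N, N′ ≥ 0` (h-free) such that for every positive definite `h`, every `α ∈ K` and every `β ∈ L`,
  `|xiShift(g, h; α, β)| ≤ C · e^{−2π Re tr(hg)} · (1 + tr h)^N · (1 + det(h)^{−N′})`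
— the three-factor shape of ★ `norm_xiEtaRhs_le₂`, so the lattice sum `Σ_β a_β(s) Ξ(y, β; s + 3∕2, s + ½)` of Φ6b-5 has its Weierstrass majorant
on compacts of `{re s > −½}` with the lattice count unchanged.
PROOF.  `xiShift g h α β = 4π⁴ e^{iπ(β−α)} Γ₂(α)⁻¹ (π Γ(β)²)⁻¹ · etaShift(2g, πh; α, β)`; the prefactor is continuous on `ℂ × ℂ` (`Γ(β)⁻¹` entire),
hence bounded on `K × L`; `|α − 2| ≤ |R₀| + 2` on `K ⊂ B(0, R₀)`; ★ `norm_etaShift_le₂` at `2g` on the box `[−R, R] × [min re L, max re L]`;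
the `π`-scalings of `tr`, `det` as in ★ `norm_xiEtaRhs_le₂`.
HONEST LABEL.  Count-neutral helper of the K2_Liu road; it pays no socket by itself: `HC_CM` is proved only modulo the 7 printed citations
(2 remaining named inputs: hLiu418 = `stmt-HodgeConjecture-24832`, h413 = `stmt-HodgeConjecture-24833`) until rung 0 closes.
-/

set_option autoImplicit false
-- the mandated namespace repeats the single-problem summit's segment (`HodgeConjecture.HodgeConjecture`)
set_option linter.dupNamespace false

noncomputable section

open Complex MeasureTheory Set
open scoped ComplexOrder ComplexConjugate

namespace Summit.HodgeConjecture.HodgeConjecture.Cruxes.HLiu418.K2LiuHermTwoXiShiftGrowth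

open Summit.HodgeConjecture.HodgeConjecture.Cruxes.HLiu418.K2LiuHermTwoGammaDefs
open Summit.HodgeConjecture.HodgeConjecture.Cruxes.HLiu418.K2LiuHermTwoEtaDefs
open Summit.HodgeConjecture.HodgeConjecture.Cruxes.HLiu418.K2LiuHermTwoEtaConvergence
open Summit.HodgeConjecture.HodgeConjecture.Cruxes.HLiu418.K2LiuHermTwoEtaHolomorphy
open Summit.HodgeConjecture.HodgeConjecture.Cruxes.HLiu418.K2LiuHermTwoXiEtaIdentity
open Summit.HodgeConjecture.HodgeConjecture.Cruxes.HLiu418.K2LiuHermTwoEtaShiftDefs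
open Summit.HodgeConjecture.HodgeConjecture.Cruxes.HLiu418.K2LiuHermTwoEtaShiftGrowth

/-- The shifted prefactor `(α, β) ↦ 4π⁴ e^{iπ(β−α)} Γ₂(α)⁻¹ (π Γ(β)²)⁻¹` is continuous on `ℂ × ℂ`. -/
theorem continuous_xiShiftPrefactor₂ :
    Continuous (fun z : ℂ × ℂ => ((4 * Real.pi ^ 4 : ℝ) : ℂ) * cexp ((Real.pi * I) * (z.2 - z.1)) * (hermTwoGamma z.1)⁻¹ *
      ((Real.pi : ℂ) * Complex.Gamma z.2 ^ 2)⁻¹) := by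
  have hΓ : Continuous (fun β : ℂ => ((Real.pi : ℂ) * Complex.Gamma β ^ 2)⁻¹) := by
    have h : (fun β : ℂ => ((Real.pi : ℂ) * Complex.Gamma β ^ 2)⁻¹) = fun β => (Real.pi : ℂ)⁻¹ * ((Complex.Gamma β)⁻¹) ^ 2 := by
      funext β
      rw [mul_inv, inv_pow]
    rw [h]
    exact continuous_const.mul ((Complex.differentiable_one_div_Gamma.continuous).pow 2)
  exact ((continuous_const.mul ((continuous_const.mul (continuous_snd.sub continuous_fst)).cexp)).mul
    (differentiable_hermTwoGamma_inv.continuous.comp continuous_fst)).mul (hΓ.comp continuous_snd)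

/-- **GROWTH OF `xiShift(g, h; α, β)` IN `h`, LOCALLY UNIFORMLY IN `(α, β) ∈ ℂ × {re β > 0}`** (co-dealer rider (b)): for `g > 0` and compact
`K ⊂ ℂ`, `L ⊂ {re β > 0}` there are `C, N, N′ ≥ 0` such that for every positive definite `h`, every `α ∈ K` and every `β ∈ L`,
  `|xiShift(g, h; α, β)| ≤ C · e^{−2π Re tr(hg)} · (1 + tr h)^N · (1 + det(h)^{−N′})`. -/
theorem norm_xiShift_le₂ {g : Matrix (Fin 2) (Fin 2) ℂ} (hg : g.PosDef) {K L : Set ℂ} (hK : IsCompact K) (hL : IsCompact L)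
    (hL0 : ∀ β ∈ L, 0 < β.re) :
    ∃ C N N' : ℝ, 0 ≤ C ∧ 0 ≤ N ∧ 0 ≤ N' ∧ ∀ h : Matrix (Fin 2) (Fin 2) ℂ, h.PosDef → ∀ α ∈ K, ∀ β ∈ L,
      ‖xiShift g h α β‖ ≤
        C * Real.exp (-(2 * Real.pi * ((h * g).trace).re)) * (1 + ((h 0 0).re + (h 1 1).re)) ^ N *
          (1 + ((h 0 0).re * (h 1 1).re - normSq (h 0 1)) ^ (-N')) := by
  -- the boxes: `|re α| ≤ R`, `|α − 2| ≤ R + 2` on `K`; `b₁ ≤ re β ≤ b₂` on `L` with `b₁ > 0`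
  obtain ⟨R₀, hR₀⟩ := hK.isBounded.subset_closedBall 0
  set R : ℝ := |R₀| with hR
  have hstrip : ∀ α ∈ K, -R ≤ α.re ∧ α.re ≤ R := fun α hα =>
    abs_le.mp (((Complex.abs_re_le_norm α).trans (mem_closedBall_zero_iff.mp (hR₀ hα))).trans (le_abs_self R₀))
  have hM : ∀ α ∈ K, ‖α - 2‖ ≤ R + 2 := fun α hα =>
    (norm_sub_le _ _).trans (add_le_add (((mem_closedBall_zero_iff.mp (hR₀ hα))).trans (le_abs_self R₀)) (by simp))
  rcases L.eq_empty_or_nonempty with hLe | hLne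
  · refine ⟨0, 0, 0, le_rfl, le_rfl, le_rfl, fun h _ α _ β hβ => ?_⟩
    rw [hLe] at hβ
    exact absurd hβ (Set.notMem_empty β)
  obtain ⟨βm, hβm, hβmin⟩ := (hL.image Complex.continuous_re).exists_isLeast (hLne.image _)
  obtain ⟨βM, hβM, hβmax⟩ := (hL.image Complex.continuous_re).exists_isGreatest (hLne.image _)
  have hbox : ∀ β ∈ L, βm ≤ β.re ∧ β.re ≤ βM := fun β hβ =>
    ⟨hβmin (Set.mem_image_of_mem _ hβ), hβmax (Set.mem_image_of_mem _ hβ)⟩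
  have hb₁0 : 0 < βm := by
    obtain ⟨β₁, hβ₁L, hβ₁eq⟩ := hβm
    rw [← hβ₁eq]
    exact hL0 β₁ hβ₁L
  have hb12 : βm ≤ βM := by
    obtain ⟨β₁, hβ₁L, hβ₁eq⟩ := hβm
    rw [← hβ₁eq]
    exact (hbox β₁ hβ₁L).2
  -- the prefactor is bounded on `K × L`
  obtain ⟨M, hMb⟩ := (hK.prod hL).exists_bound_of_continuousOn continuous_xiShiftPrefactor₂.continuousOn
  -- the growth of `etaShift` at `(2g, πh)` on the box
  obtain ⟨d, rfl⟩ : ∃ d : ℝ × ℂ × ℝ, hermTwo d = g := ⟨_, hermTwo_eq_of_isHermitian hg.1⟩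
  have h2 : (2 : ℂ) • hermTwo d = hermTwo ((2 : ℝ) • d) := by rw [hermTwo_smul]; norm_num
  have h2g : (hermTwo ((2 : ℝ) • d)).PosDef := posDef_hermTwo_smul two_pos hg
  have hR2 : 0 ≤ R + 2 := by positivity
  obtain ⟨C, hC, hB⟩ := norm_etaShift_le₂ h2g (a₁ := -R) (a₂ := R) (by linarith [abs_nonneg R₀]) hb₁0 hb12 hR2
  set N : ℝ := 2 * max (R - 2) 0 + 1 with hN
  set N' : ℝ := max (2 - -R) 0 + 1 with hN'
  have hN0 : 0 ≤ N := by positivity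
  have hN'0 : 0 ≤ N' := by positivity
  refine ⟨max M 0 * (C * Real.pi ^ N), N, N', by positivity, hN0, hN'0, fun h hh α hα β hβ => ?_⟩
  obtain ⟨e, rfl⟩ : ∃ e : ℝ × ℂ × ℝ, hermTwo e = h := ⟨_, hermTwo_eq_of_isHermitian hh.1⟩
  have heh := (posDef_hermTwo_iff e).mp hh
  have he1 : 0 < e.1 := heh.1
  have he2 : 0 < e.2.2 := snd_pos_of_cone heh.1 heh.2
  have hδ : 0 < e.1 * e.2.2 - normSq e.2.1 := by linarith [heh.2]
  have hπe : (hermTwo (Real.pi • e)).PosDef := posDef_hermTwo_smul Real.pi_pos hh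
  have hη := hB (hermTwo (Real.pi • e)) hπe α β (hstrip α hα).1 (hstrip α hα).2 (hbox β hβ).1 (hbox β hβ).2 (hM α hα)
  simp only [hermTwo_apply_zero_zero, hermTwo_apply_one_one, hermTwo_apply_zero_one, Prod.smul_fst, Prod.smul_snd, smul_eq_mul,
    Complex.real_smul, ofReal_re, trace_hermTwo_mul_hermTwo, map_mul, normSq_ofReal] at hη
  simp only [hermTwo_apply_zero_zero, hermTwo_apply_one_one, hermTwo_apply_zero_one, ofReal_re, trace_hermTwo_mul_hermTwo]
  rw [xiShift_def, h2, ← hermTwo_smul, norm_mul]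
  have hT : Real.pi * e.1 * (2 * d.1) + Real.pi * e.2.2 * (2 * d.2.2) +
      2 * ((Real.pi : ℂ) * e.2.1 * (conj ((2 : ℝ) : ℂ) * conj d.2.1)).re =
      2 * Real.pi * (e.1 * d.1 + e.2.2 * d.2.2 + 2 * (e.2.1 * conj d.2.1).re) := by
    simp only [Complex.conj_ofReal, Complex.mul_re, Complex.mul_im, Complex.conj_re, Complex.conj_im, Complex.ofReal_re,
      Complex.ofReal_im]
    ring
  have hdet : Real.pi * e.1 * (Real.pi * e.2.2) - Real.pi * Real.pi * normSq e.2.1 = Real.pi ^ 2 * (e.1 * e.2.2 - normSq e.2.1) := by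
    ring
  rw [hT, hdet] at hη
  have hπ3 := Real.pi_gt_three
  have htr : (1 + (Real.pi * e.1 + Real.pi * e.2.2)) ^ N ≤ Real.pi ^ N * (1 + (e.1 + e.2.2)) ^ N := by
    rw [← Real.mul_rpow Real.pi_pos.le (by linarith [heh.1])]
    exact Real.rpow_le_rpow (by nlinarith [heh.1]) (by nlinarith [heh.1]) hN0
  have hdt : 1 + (Real.pi ^ 2 * (e.1 * e.2.2 - normSq e.2.1)) ^ (-N') ≤ 1 + (e.1 * e.2.2 - normSq e.2.1) ^ (-N') := by
    rw [Real.mul_rpow (by positivity) hδ.le]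
    have h1 : (Real.pi ^ 2) ^ (-N') ≤ 1 := Real.rpow_le_one_of_one_le_of_nonpos (by nlinarith) (by linarith)
    nlinarith [Real.rpow_nonneg hδ.le (-N')]
  have hP : 0 ≤ Real.pi ^ N * (1 + (e.1 + e.2.2)) ^ N := by positivity
  have hQ : 0 ≤ 1 + (Real.pi ^ 2 * (e.1 * e.2.2 - normSq e.2.1)) ^ (-N') := by
    linarith [Real.rpow_nonneg (show (0 : ℝ) ≤ Real.pi ^ 2 * (e.1 * e.2.2 - normSq e.2.1) by positivity) (-N')]
  have hη' := hη.trans (mul_le_mul_of_nonneg_left (mul_le_mul htr hdt hQ hP)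
    (mul_nonneg hC (Real.exp_pos (-(2 * Real.pi * (e.1 * d.1 + e.2.2 * d.2.2 + 2 * (e.2.1 * conj d.2.1).re)))).le))
  have hpre : ‖((4 * Real.pi ^ 4 : ℝ) : ℂ) * cexp ((Real.pi * I) * (β - α)) * (hermTwoGamma α)⁻¹ * ((Real.pi : ℂ) * Complex.Gamma β ^ 2)⁻¹‖ ≤
      max M 0 :=
    (hMb (α, β) (Set.mk_mem_prod hα hβ)).trans (le_max_left _ _)
  calc ‖((4 * Real.pi ^ 4 : ℝ) : ℂ) * cexp ((Real.pi * I) * (β - α)) * (hermTwoGamma α)⁻¹ * ((Real.pi : ℂ) * Complex.Gamma β ^ 2)⁻¹‖ *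
        ‖etaShift (hermTwo ((2 : ℝ) • d)) (hermTwo (Real.pi • e)) α β‖
      ≤ max M 0 * (C * Real.exp (-(2 * Real.pi * (e.1 * d.1 + e.2.2 * d.2.2 + 2 * (e.2.1 * conj d.2.1).re))) *
          (Real.pi ^ N * (1 + (e.1 + e.2.2)) ^ N * (1 + (e.1 * e.2.2 - normSq e.2.1) ^ (-N')))) :=
        mul_le_mul hpre hη' (norm_nonneg _) (le_max_right _ _)
    _ = _ := by ring

end Summit.HodgeConjecture.HodgeConjecture.Cruxes.HLiu418.K2LiuHermTwoXiShiftGrowth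

end
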